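import Summits.QuantumFields.QCD.Theorems.PauliWegnerSeaChiralOneScaleTrajectoryBridges

/-!
# Sign coherence at the scheme volume is automatic for two degenerate flavours (line `Sketch`, crux
`PauliWegnerSea.ChiralOneScaleTrajectory`, stmt-QuantumFields-17512)

`signCoh_two`: at `N_f = 2` the kernel Sign₃ of `signedPin_of_lowerPins_signCoh` holds with `θ = 1` for every
regularisation, flavour and mass: `det D = (det D_t)² = |det D|` (`det_diracMatrix_two_degenerate_eq_norm`), so the
signed second-moment quotient at the scheme volume is the unsigned one cast to `ℂ`.  Folklore.
-/

noncomputable section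

namespace Summit.QuantumFields.QCD.Cruxes.ChiralOneScaleTrajectory.GoldstoneWitness

open scoped BigOperators
open MeasureTheory Filter
open Literature.MathematicalPhysics.QuantumFieldTheory Literature.MathematicalPhysics.QuantumLattice
  Literature.Probability.LatticeModels

/-- **`N_f = 2`: sign coherence of the pion integrand at the scheme volume holds with `θ = 1`.** -/
theorem signCoh_two :
    ∀ (reg : QCDRegularisation 2) (f : Fin 2), ∃ θ : ℝ, 0 < θ ∧ ∀ m : ℝ, 0 < m → ∀ᶠ k in atTop, θ * ((∫ U : GaugeConfig 4 (2 * reg.L k + 1) (Matrix.specialUnitaryGroup (Fin 3) ℂ), ‖(diracMatrix U fun _ : Fin 2 => reg.mcrit k + reg.a k * m / reg.Zm k).det‖ * (∑ a : Fin 3, ∑ i : Fin 4, ∑ b : Fin 3, ∑ j : Fin 4, ‖(diracMatrix U fun _ : Fin 2 => reg.mcrit k + reg.a k * m / reg.Zm k)⁻¹ (quarkEquiv (f, (Torus.proj (2 * reg.L k + 1) 0, a, i))) (quarkEquiv (f, (Torus.proj (2 * reg.L k + 1) (Pi.single 0 (reg.L k : ℤ)), b, j)))‖ ^ (2 : ℕ))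 ∂(wilsonMeasure (fundamentalRep (Fin 3)) (reg.β k))) / (∫ U : GaugeConfig 4 (2 * reg.L k + 1) (Matrix.specialUnitaryGroup (Fin 3) ℂ), ‖(diracMatrix U fun _ : Fin 2 => reg.mcrit k + reg.a k * m / reg.Zm k).det‖ ∂(wilsonMeasure (fundamentalRep (Fin 3)) (reg.β k)))) ≤ ‖(∫ U : GaugeConfig 4 (2 * reg.L k + 1) (Matrix.specialUnitaryGroup (Fin 3) ℂ), (diracMatrix U fun _ : Fin 2 => reg.mcrit k + reg.a k * m / reg.Zm k).det * ((∑ a : Fin 3, ∑ i : Fin 4, ∑ b : Fin 3, ∑ j : Fin 4, ‖(diracMatrix U fun _ : Fin 2 => reg.mcrit k + reg.a k * m / reg.Zm k)⁻¹ (quarkEquiv (f, (Torus.proj (2 * reg.L k + 1) 0, a, i))) (quarkEquiv (f, (Torus.proj (2 * reg.L k + 1) (Pi.single 0 (reg.L k : ℤ)), b, j)))‖ ^ (2 : ℕ) : ℝ) : ℂ) ∂(wilsonMeasure (fundamentalRep (Fin 3)) (reg.β k))) / (∫ U : GaugeConfig 4 (2 * reg.L k + 1) (Matrix.specialUnitaryGroup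 (Fin 3) ℂ), (diracMatrix U fun _ : Fin 2 => reg.mcrit k + reg.a k * m / reg.Zm k).det ∂(wilsonMeasure (fundamentalRep (Fin 3)) (reg.β k)))‖ := by
  intro reg f
  refine ⟨1, one_pos, fun m _ => Eventually.of_forall fun k => ?_⟩
  set mq : Fin 2 → ℝ := fun _ => reg.mcrit k + reg.a k * m / reg.Zm k with hmq
  set μ := wilsonMeasure (d := 4) (L := 2 * reg.L k + 1) (fundamentalRep (Fin 3)) (reg.β k) with hμ
  set X : GaugeConfig 4 (2 * reg.L k + 1) (Matrix.specialUnitaryGroup (Fin 3) ℂ) → ℝ := fun U =>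
    ∑ a : Fin 3, ∑ i : Fin 4, ∑ b : Fin 3, ∑ j : Fin 4,
      ‖(diracMatrix U mq)⁻¹ (quarkEquiv (f, (Torus.proj (2 * reg.L k + 1) 0, a, i)))
        (quarkEquiv (f, (Torus.proj (2 * reg.L k + 1) (Pi.single 0 (reg.L k : ℤ)), b, j)))‖ ^ (2 : ℕ) with hX
  have hdet : ∀ U : GaugeConfig 4 (2 * reg.L k + 1) (Matrix.specialUnitaryGroup (Fin 3) ℂ),
      (diracMatrix U mq).det = ((‖(diracMatrix U mq).det‖ : ℝ) : ℂ) := fun U =>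
    det_diracMatrix_two_degenerate_eq_norm U _
  have hnum : (∫ U, (diracMatrix U mq).det * ((X U : ℝ) : ℂ) ∂μ) =
      ((∫ U, ‖(diracMatrix U mq).det‖ * X U ∂μ : ℝ) : ℂ) := by
    rw [← integral_complex_ofReal]
    refine integral_congr_ae (Eventually.of_forall fun U => ?_)
    beta_reduce
    rw [Complex.ofReal_mul, ← hdet U]
  have hden : (∫ U, (diracMatrix U mq).det ∂μ) = ((∫ U, ‖(diracMatrix U mq).det‖ ∂μ : ℝ) : ℂ) := by
    rw [← integral_complex_ofReal]
    exact integral_congr_ae (Eventually.of_forall fun U => hdet U)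
  change 1 * ((∫ U, ‖(diracMatrix U mq).det‖ * X U ∂μ) / (∫ U, ‖(diracMatrix U mq).det‖ ∂μ)) ≤
    ‖(∫ U, (diracMatrix U mq).det * ((X U : ℝ) : ℂ) ∂μ) / (∫ U, (diracMatrix U mq).det ∂μ)‖
  rw [one_mul, hnum, hden, ← Complex.ofReal_div, Complex.norm_real, Real.norm_eq_abs]
  exact le_abs_self _

end Summit.QuantumFields.QCD.Cruxes.ChiralOneScaleTrajectory.GoldstoneWitness

end
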